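import Summits.CriticalPhenomena.PercolationContinuityZ3.Theorems.Transplant.SkelPhiNegReachReadBK
import HarnessLib

/-!
# N2 (frames-only node `SamePDropOfSkeletonFrm₁`, OPEN), (R) column, reading rows — **THE PAIRED (DE-SHEARED) READING OF A DRIFTING BOX**
# `KS.pairing_bounds`: for a box `[lo, hi]` with `x ∈ X + k·v ± B` and rows `∈ [k·σ − Q, k·σ′ + Q]` the along reading numerators
# `m·hi₀ − min(v·U·lo₁, v·(U·hi₁ + U − 1))` / `m·lo₀ − max(…)` are within `m·(X ± B) ± (2U·K_b·n + n·(U·Q + U))` — the drift `k·v` CANCELS against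
# the rows `k·σ` up to `k·|v|·|m − U·σ| ≤ 2U·k·|v|` ((R-50): the root's y′-corridor is read PER REGION)

Pure integer arithmetic (sign split on `v`); consumed with `Skelφ.rdHi_zero_leK / rdLo_zero_geK` (SkelPhiNegReachReadBK).
NON-VACUITY (lead g11 standing order): an inequality lemma over ℤ; nothing assumed.
builds on p205010 (kernel theorem, internal audit signed; external expert review pending) — nothing in this file uses p205010; NOTHING is claimed
about the open node `SamePDropOfSkeletonFrm₁`.
Lane `prim-bschramm`, seat `prim-bschramm-p3` (gen 18; N2 design owner, (R) column owner); helper file (`--supports stmt-CriticalPhenomena-4575 --as helper`).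
[cite: KozmaNitzan2024, §4 p. 28 ((32) at the root)]
-/

noncomputable section

namespace Summit.CriticalPhenomena.PercolationContinuityZ3.Theorems.Transplant

open Literature.Probability.Percolation Literature.Probability.LatticeModels

namespace PlanarSkeletonFrm

namespace NegB

namespace KS

/-- **PAIRED READING BOUNDS** (see the module docstring). [this work] -/
theorem pairing_bounds {m U v σ σ' X B Q k Kb nn : ℤ} {lo hi : Site 2}
    (hm : 0 ≤ m) (hU : 1 ≤ U) (hk0 : 0 ≤ k) (hkN : k ≤ Kb) (hv : |v| ≤ nn) (hQ : 0 ≤ Q)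
    (hσ1 : m - U * σ ≤ 2 * U) (hσ3 : U * σ' - m ≤ 2 * U)
    (hlo0 : X + k * v - B ≤ lo 0) (hhi0 : hi 0 ≤ X + k * v + B) (hlo1 : k * σ - Q ≤ lo 1) (hhi1 : hi 1 ≤ k * σ' + Q) (hne : lo 1 ≤ hi 1) :
    m * hi 0 - min (v * (U * lo 1)) (v * (U * hi 1 + U - 1)) ≤ m * (X + B) + 2 * U * Kb * nn + nn * (U * Q + U) ∧
    m * (X - B) - 2 * U * Kb * nn - nn * (U * Q + U) ≤ m * lo 0 - max (v * (U * lo 1)) (v * (U * hi 1 + U - 1)) := by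
  have hU0 : 0 ≤ U := by linarith
  have hnn : 0 ≤ nn := (abs_nonneg v).trans hv
  have hva : v ≤ nn := (le_abs_self v).trans hv
  have hva' : -nn ≤ v := by linarith [neg_abs_le v]
  have hkv : |k * v| ≤ Kb * nn := by rw [abs_mul, abs_of_nonneg hk0]; exact mul_le_mul hkN hv (abs_nonneg v) (hk0.trans hkN)
  obtain ⟨hkv1, hkv2⟩ := abs_le.1 hkv
  have hmhi : m * hi 0 ≤ m * (X + k * v + B) := mul_le_mul_of_nonneg_left hhi0 hm
  have hmlo : m * (X + k * v - B) ≤ m * lo 0 := mul_le_mul_of_nonneg_left hlo0 hm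
  have hUl : U * lo 1 ≤ U * hi 1 + U - 1 := by nlinarith
  by_cases hv0 : 0 ≤ v
  · -- v ≥ 0: min ≥ v·U·(kσ − Q), max ≤ v·U·(kσ′ + Q) + v·(U − 1)
    have hmin : v * (U * (k * σ - Q)) ≤ min (v * (U * lo 1)) (v * (U * hi 1 + U - 1)) := by
      refine le_min ?_ ?_
      · exact mul_le_mul_of_nonneg_left (mul_le_mul_of_nonneg_left hlo1 hU0) hv0
      · exact mul_le_mul_of_nonneg_left ((mul_le_mul_of_nonneg_left hlo1 hU0).trans hUl) hv0
    have hmax : max (v * (U * lo 1)) (v * (U * hi 1 + U - 1)) ≤ v * (U * (k * σ' + Q)) + v * (U - 1) := by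
      have hb : v * (U * hi 1 + U - 1) ≤ v * (U * (k * σ' + Q)) + v * (U - 1) := by
        have h1 := mul_le_mul_of_nonneg_left (mul_le_mul_of_nonneg_left hhi1 hU0) hv0
        have e : v * (U * hi 1 + U - 1) = v * (U * hi 1) + v * (U - 1) := by ring
        rw [e]; linarith
      refine max_le ?_ hb
      exact (mul_le_mul_of_nonneg_left hUl hv0).trans hb
    -- the drift terms
    have hd1 : k * v * (m - U * σ) ≤ 2 * U * Kb * nn := by
      have h1 : k * v * (m - U * σ) ≤ k * v * (2 * U) := mul_le_mul_of_nonneg_left hσ1 (mul_nonneg hk0 hv0)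
      have h2 : k * v * (2 * U) ≤ Kb * nn * (2 * U) := mul_le_mul_of_nonneg_right hkv2 (by linarith)
      linarith
    have hd2 : -(2 * U * Kb * nn) ≤ k * v * (m - U * σ') := by
      have h1 : k * v * (-(2 * U)) ≤ k * v * (m - U * σ') := mul_le_mul_of_nonneg_left (by linarith) (mul_nonneg hk0 hv0)
      have h2 : k * v * (2 * U) ≤ Kb * nn * (2 * U) := mul_le_mul_of_nonneg_right hkv2 (by linarith)
      linarith
    have hq1 : v * (U * Q) ≤ nn * (U * Q) := mul_le_mul_of_nonneg_right hva (mul_nonneg hU0 hQ)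
    have hq2 : v * (U - 1) ≤ nn * U := by
      have h1 : v * (U - 1) ≤ nn * (U - 1) := mul_le_mul_of_nonneg_right hva (by linarith)
      nlinarith
    constructor
    · calc m * hi 0 - min (v * (U * lo 1)) (v * (U * hi 1 + U - 1)) ≤ m * (X + k * v + B) - v * (U * (k * σ - Q)) := by linarith
        _ = m * (X + B) + k * v * (m - U * σ) + v * (U * Q) := by ring
        _ ≤ m * (X + B) + 2 * U * Kb * nn + nn * (U * Q + U) := by nlinarith
    · calc m * (X - B) - 2 * U * Kb * nn - nn * (U * Q + U) ≤ m * (X + k * v - B) - (v * (U * (k * σ' + Q)) + v * (U - 1)) := by nlinarith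
        _ = m * (X + k * v - B) - (v * (U * (k * σ' + Q)) + v * (U - 1)) := rfl
        _ ≤ m * lo 0 - max (v * (U * lo 1)) (v * (U * hi 1 + U - 1)) := by linarith
  · -- v < 0: min ≥ v·(U·(kσ′ + Q) + U − 1), max ≤ v·U·(kσ − Q)
    have hv0' : v ≤ 0 := (not_le.1 hv0).le
    have hw0 : 0 ≤ -v := by linarith
    have hmin : v * (U * (k * σ' + Q) + U - 1) ≤ min (v * (U * lo 1)) (v * (U * hi 1 + U - 1)) := by
      refine le_min ?_ ?_
      · have h1 : v * (U * hi 1 + U - 1) ≤ v * (U * lo 1) := mul_le_mul_of_nonpos_left hUl hv0'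
        have h2 : v * (U * (k * σ' + Q) + U - 1) ≤ v * (U * hi 1 + U - 1) :=
          mul_le_mul_of_nonpos_left (by linarith [mul_le_mul_of_nonneg_left hhi1 hU0]) hv0'
        exact h2.trans h1
      · exact mul_le_mul_of_nonpos_left (by linarith [mul_le_mul_of_nonneg_left hhi1 hU0]) hv0'
    have hmax : max (v * (U * lo 1)) (v * (U * hi 1 + U - 1)) ≤ v * (U * (k * σ - Q)) := by
      refine max_le ?_ ?_
      · exact mul_le_mul_of_nonpos_left (mul_le_mul_of_nonneg_left hlo1 hU0) hv0'
      · exact (mul_le_mul_of_nonpos_left hUl hv0').trans (mul_le_mul_of_nonpos_left (mul_le_mul_of_nonneg_left hlo1 hU0) hv0')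
    have hkw : k * (-v) ≤ Kb * nn := by
      have : |k * v| = k * (-v) := by rw [abs_mul, abs_of_nonneg hk0, abs_of_nonpos hv0']
      linarith [this ▸ hkv]
    have hd1 : k * v * (m - U * σ') ≤ 2 * U * Kb * nn := by
      -- k·v·(m − Uσ′) = k·(−v)·(Uσ′ − m) ≤ k·(−v)·2U
      have h1 : k * (-v) * (U * σ' - m) ≤ k * (-v) * (2 * U) := mul_le_mul_of_nonneg_left hσ3 (mul_nonneg hk0 hw0)
      have h2 : k * (-v) * (2 * U) ≤ Kb * nn * (2 * U) := mul_le_mul_of_nonneg_right hkw (by linarith)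
      have e : k * v * (m - U * σ') = k * (-v) * (U * σ' - m) := by ring
      rw [e]; linarith
    have hd2 : -(2 * U * Kb * nn) ≤ k * v * (m - U * σ) := by
      have h1 : k * (-v) * (m - U * σ) ≤ k * (-v) * (2 * U) := mul_le_mul_of_nonneg_left hσ1 (mul_nonneg hk0 hw0)
      have h2 : k * (-v) * (2 * U) ≤ Kb * nn * (2 * U) := mul_le_mul_of_nonneg_right hkw (by linarith)
      have e : k * v * (m - U * σ) = -(k * (-v) * (m - U * σ)) := by ring
      rw [e]; linarith
    have hq1 : (-v) * (U * Q) ≤ nn * (U * Q) := mul_le_mul_of_nonneg_right (by linarith) (mul_nonneg hU0 hQ)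
    have hq2 : (-v) * (U - 1) ≤ nn * U := by
      have h1 : (-v) * (U - 1) ≤ nn * (U - 1) := mul_le_mul_of_nonneg_right (by linarith) (by linarith)
      nlinarith
    constructor
    · calc m * hi 0 - min (v * (U * lo 1)) (v * (U * hi 1 + U - 1)) ≤ m * (X + k * v + B) - v * (U * (k * σ' + Q) + U - 1) := by linarith
        _ = m * (X + B) + k * v * (m - U * σ') + (-v) * (U * Q) + (-v) * (U - 1) := by ring
        _ ≤ m * (X + B) + 2 * U * Kb * nn + nn * (U * Q + U) := by nlinarith
    · calc m * (X - B) - 2 * U * Kb * nn - nn * (U * Q + U) ≤ m * (X + k * v - B) - v * (U * (k * σ - Q)) := by nlinarith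
        _ ≤ m * lo 0 - max (v * (U * lo 1)) (v * (U * hi 1 + U - 1)) := by linarith

end KS

end NegB

end PlanarSkeletonFrm

end Summit.CriticalPhenomena.PercolationContinuityZ3.Theorems.Transplant

end
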